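import Summits.CriticalPhenomena.PercolationContinuityZ3.Theorems.PercNearOneGluingNoHeavyLowerTailAntipodalR1Adjacent
import HarnessLib

/-!
# The antipodal form of the refined row R1 for nested terminal neighbourhoods

Support file for `stmt-CriticalPhenomena-4575` (memos `prim-gen-kcluster/KCLUSTER-gen60.md` §4c and
`KCLUSTER-gen63.md`; conjecture ANTI₁ of `KCLUSTER-gen52.md` §3).  Vocabulary of
`PercNearOneGluingNoHeavyLowerTailAntipodalR1Adjacent`: a finite multigraph `ends : ι → Sym2 V`,
2-colourings `x : ι → Bool` (`true` = open), the open / closed clusters `O_a`, `K_a` of the apex `a`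
(`AntipodalR1.clus`), and the two sides of ANTI₁,
`L = {x : b, c ∈ O_a ∖ K_a, K_a meets every b–c path}` (`AntipodalR1.lSet`) and
`R(b,c) = {x : b ∈ O_a ∖ K_a, c ∈ K_a ∖ O_a}` (`AntipodalR1.rSet`).

**Theorem** (`AntipodalR1.card_lSet_le_card_rSet_of_nested`).  If `b` and `c` are not adjacent and
every neighbour of `c` is a neighbour of `b` (`N(c) ⊆ N(b)`), then `#L ≤ #R(b,c)`: the map
`x ↦ x △ star(c)` (flip every edge at `c`) is an injection `L → R(b,c)`
(`AntipodalR1.flipStar_mem_rSet`).  Together with `AntipodalR1.card_lSet_le_card_rSet_of_adj` (apex adjacent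
to both terminals) this is the second infinite class on which the antipodal row is a theorem; the class
contains `K_n − bc`, `K_{2,n}` and every terminal of degree at most two lying inside the other
terminal's neighbourhood.

Proof.  Let `x ∈ L` and let `y` be a neighbour of `c`.  Then `b – y – c` is a path of the support, and
`K_a` meets it; since `b, c ∉ K_a` we get `y ∈ K_a` (`AntipodalR1.nbr_of_apex_mem_clus`), and the edge
`cy` is open (a closed edge into `K_a` would put `c` into `K_a`).  So every edge at `c` is open, and every
edge `by`, `y ∈ N(c)`, is open as well.  In `x' = x △ star(c)`: `c` is joined to `K_a` by closed edges,
so `c ∈ K'_a`; `c` has no open edge, so `c ∉ O'_a`; a closed `a–b` path of `x'` either avoids `c` (then it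
is closed in `x`) or leaves `c` through a neighbour `y ∈ K_a` and continues by closed edges of `x`, so
`b ∉ K'_a`; and an open `a–b` path of `x` through `c` enters `c` from some `y ∈ N(c)`, whence
`a ~ y – b` is open in `x'`, so `b ∈ O'_a`.  The map is an involution, hence injective.  (It also
preserves the grade `k(O)+k(K)` — `c` becomes an open singleton while its closed singleton merges into
the component of `K_a` — a refinement not formalised here.)  The file is definition-free: the flipped
colouring `x'` enters the lemmas through its defining equation `hx'`.  [this work]
-/

namespace Summit.CriticalPhenomena.PercolationContinuityZ3.Theorems

namespace AntipodalR1

open Finset Relation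

variable {V ι : Type*}

section Nested

variable [Fintype ι] [DecidableEq ι] {ends : ι → Sym2 V} {a b c : V} {x x' : ι → Bool}

/-- Unfolding membership in `L`. [this work] -/
theorem mem_lSet : x ∈ lSet ends a b c ↔ b ∈ clus ends x true a ∧ b ∉ clus ends x false a ∧
    c ∈ clus ends x true a ∧ c ∉ clus ends x false a ∧ c ∉ region ends x a b := by
  classical
  simp [lSet]

/-- Unfolding membership in `R(b,c)`. [this work] -/
theorem mem_rSet : x ∈ rSet ends a b c ↔ b ∈ clus ends x true a ∧ b ∉ clus ends x false a ∧
    c ∈ clus ends x false a ∧ c ∉ clus ends x true a := by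
  classical
  simp [rSet]

omit [Fintype ι] [DecidableEq ι] in
/-- An edge containing `c` has the form `cy`. [this work] -/
theorem eq_mk_of_mem {e : ι} {u w : V} (he : ends e = s(u, w)) (hc : c ∈ ends e) :
    ∃ y, ends e = s(c, y) ∧ (y = u ∨ y = w) := by
  rw [he, Sym2.mem_iff] at hc
  rcases hc with rfl | rfl
  · exact ⟨w, he, Or.inr rfl⟩
  · exact ⟨u, by rw [he, Sym2.eq_swap], Or.inl rfl⟩

/-- **Key lemma.**  For `x ∈ L` with `b ≁ c` and `N(c) ⊆ N(b)`: every neighbour `y` of `c` lies in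
`K_a`, the edge `cy` is open, and `y ≠ c`. [this work] -/
theorem nbr_of_apex_mem_clus (hbc : ∀ e, ends e ≠ s(b, c))
    (hN : ∀ e y, ends e = s(c, y) → ∃ e', ends e' = s(b, y)) (hx : x ∈ lSet ends a b c)
    {e : ι} {y : V} (he : ends e = s(c, y)) :
    y ∈ clus ends x false a ∧ x e = true ∧ y ≠ c := by
  obtain ⟨_, hbK, _, hcK, hreg⟩ := mem_lSet.1 hx
  obtain ⟨e', he'⟩ := hN e y he
  have hyc : y ≠ c := by
    rintro rfl
    exact hbc e' he'
  have hyK : y ∈ clus ends x false a := by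
    by_contra hy
    apply hreg
    rw [mem_region]
    have h1 : y ∈ freeNbr ends x a b := ⟨⟨e', he'⟩, hbK, hy⟩
    have h2 : c ∈ freeNbr ends x a y := ⟨⟨e, by rw [he, Sym2.eq_swap]⟩, hy, hcK⟩
    exact ReflTransGen.tail (ReflTransGen.tail ReflTransGen.refl h1) h2
  refine ⟨hyK, ?_, hyc⟩
  cases hxe : x e
  · exact absurd (clus_step hyK ⟨e, hxe, by rw [he, Sym2.eq_swap]⟩) hcK
  · rfl

open Classical in
/-- For `x ∈ L`, the flip `x' = x △ star(c)` only closes edges, so `K_a` can only grow. [this work] -/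
theorem clus_false_subset_flipStar (hbc : ∀ e, ends e ≠ s(b, c))
    (hN : ∀ e y, ends e = s(c, y) → ∃ e', ends e' = s(b, y)) (hx : x ∈ lSet ends a b c)
    (hx' : ∀ e, x' e = if c ∈ ends e then !x e else x e) {v : V}
    (hv : v ∈ clus ends x false a) : v ∈ clus ends x' false a := by
  rw [mem_clus] at hv ⊢
  induction hv with
  | refl => exact ReflTransGen.refl
  | tail _ huw ih =>
    obtain ⟨e, hxe, he⟩ := huw
    refine ih.tail ⟨e, ?_, he⟩
    by_cases hc : c ∈ ends e
    · obtain ⟨y, hey, -⟩ := eq_mk_of_mem he hc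
      have := (nbr_of_apex_mem_clus hbc hN hx hey).2.1
      rw [hxe] at this
      exact absurd this (by decide)
    · rw [hx' e, if_neg hc, hxe]

open Classical in
/-- **The flip at `c` maps `L` into `R(b,c)`** (for `b ≁ c`, `N(c) ⊆ N(b)`): if `x ∈ L` and
`x' = x △ star(c)` then `x' ∈ R(b,c)`. [this work] -/
theorem flipStar_mem_rSet (hbc : ∀ e, ends e ≠ s(b, c))
    (hN : ∀ e y, ends e = s(c, y) → ∃ e', ends e' = s(b, y)) (hx : x ∈ lSet ends a b c)
    (hx' : ∀ e, x' e = if c ∈ ends e then !x e else x e) :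
    x' ∈ rSet ends a b c := by
  obtain ⟨hbO, hbK, hcO, hcK, hreg⟩ := mem_lSet.1 hx
  have hac : a ≠ c := by
    rintro rfl
    exact hcK ReflTransGen.refl
  have hbc' : b ≠ c := by
    rintro rfl
    exact hreg ReflTransGen.refl
  -- every edge at `c` is open in `x`, every neighbour of `c` is in `K_a`
  have key : ∀ {e : ι} {y : V}, ends e = s(c, y) → y ∈ clus ends x false a ∧ x e = true ∧ y ≠ c :=
    fun he => nbr_of_apex_mem_clus hbc hN hx he
  have hflip : ∀ {e : ι}, c ∈ ends e → x' e = !x e := fun hc => by rw [hx', if_pos hc]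
  have hkeep : ∀ {e : ι}, c ∉ ends e → x' e = x e := fun hc => by rw [hx', if_neg hc]
  -- the edges `b y`, `y ∈ N(c)`, are open and untouched by the flip
  have hby : ∀ {e' : ι} {y : V}, ends e' = s(b, y) → y ∈ clus ends x false a → y ≠ c →
      x' e' = true := by
    intro e' y he' hyK hyc
    have hopen : x e' = true := by
      cases hxe : x e'
      · exact absurd (clus_step hyK ⟨e', hxe, by rw [he', Sym2.eq_swap]⟩) hbK
      · rfl
    have hce' : c ∉ ends e' := by
      rw [he', Sym2.mem_iff]
      rintro (rfl | rfl)
      · exact hbc' rfl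
      · exact hyc rfl
    rw [hkeep hce', hopen]
  refine mem_rSet.2 ⟨?_, ?_, ?_, ?_⟩
  · -- (1) `b ∈ O'_a`: induction along an open `a–b` path of `x`
    have main : ∀ v, ReflTransGen (fun u w => w ∈ nbr ends x true u) a v →
        (v ≠ c → v ∈ clus ends x' true a) ∧
        (v = c → ∃ y, y ∈ clus ends x' true a ∧ ∃ e, ends e = s(c, y)) := by
      intro v hv
      induction hv with
      | refl => exact ⟨fun _ => ReflTransGen.refl, fun h => absurd h hac⟩
      | @tail v w _ hvw ih =>
        obtain ⟨e, hxe, he⟩ := hvw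
        by_cases hwc : w = c
        · subst hwc
          refine ⟨fun h => absurd rfl h, fun _ => ?_⟩
          by_cases hvc : v = w
          · subst hvc
            exact ih.2 rfl
          · exact ⟨v, ih.1 hvc, e, by rw [he, Sym2.eq_swap]⟩
        · refine ⟨fun _ => ?_, fun h => absurd h hwc⟩
          by_cases hvc : v = c
          · subst hvc
            obtain ⟨y, hyS, ey, hey⟩ := ih.2 rfl
            obtain ⟨hyK, -, hyc⟩ := key hey
            obtain ⟨hwK, -, -⟩ := key he
            obtain ⟨e₁, he₁⟩ := hN ey y hey
            obtain ⟨e₂, he₂⟩ := hN e w he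
            have h1 : b ∈ clus ends x' true a :=
              clus_step hyS ⟨e₁, hby he₁ hyK hyc, by rw [he₁, Sym2.eq_swap]⟩
            exact clus_step h1 ⟨e₂, hby he₂ hwK hwc, he₂⟩
          · have hce : c ∉ ends e := by
              rw [he, Sym2.mem_iff]
              rintro (rfl | rfl)
              · exact hvc rfl
              · exact hwc rfl
            exact clus_step (ih.1 hvc) ⟨e, by rw [hkeep hce, hxe], he⟩
    exact (main b hbO).1 hbc'
  · -- (2) `b ∉ K'_a`: a closed `a–b` path of `x'` stays inside `K_a ∪ {c}`
    have main : ∀ v, ReflTransGen (fun u w => w ∈ nbr ends x' false u) a v →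
        v ∈ clus ends x false a ∨ v = c := by
      intro v hv
      induction hv with
      | refl => exact Or.inl ReflTransGen.refl
      | @tail v w _ hvw ih =>
        obtain ⟨e, hxe, he⟩ := hvw
        by_cases hwc : w = c
        · exact Or.inr hwc
        · left
          by_cases hc : c ∈ ends e
          · obtain ⟨y, hey, hy⟩ := eq_mk_of_mem he hc
            rcases hy with rfl | rfl
            · rw [he, Sym2.mem_iff] at hc
              rcases hc with rfl | rfl
              · exact (key he).1
              · exact absurd rfl hwc
            · exact (key hey).1
          · rcases ih with hvK | rfl
            · exact clus_step hvK ⟨e, by rwa [hkeep hc] at hxe, he⟩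
            · exact absurd (by rw [he]; exact Sym2.mem_mk_left _ _) hc
    intro hb
    rcases main b hb with hbK' | hbc''
    · exact hbK hbK'
    · exact hbc' hbc''
  · -- (3) `c ∈ K'_a`: the last edge of an open `a–c` path of `x` is now a closed edge from `K_a`
    rw [mem_clus] at hcO
    rcases (ReflTransGen.cases_tail_iff _ _ _).1 hcO with h | ⟨y, hay, hyc⟩
    · exact absurd h.symm hac
    · obtain ⟨e, hxe, he⟩ := hyc
      have hey : ends e = s(c, y) := by rw [he, Sym2.eq_swap]
      obtain ⟨hyK, -, -⟩ := key hey
      have hyK' := clus_false_subset_flipStar hbc hN hx hx' hyK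
      refine clus_step hyK' ⟨e, ?_, he⟩
      rw [hflip (by rw [hey]; exact Sym2.mem_mk_left _ _), hxe]
      rfl
  · -- (4) `c ∉ O'_a`: `c` has no open edge in `x'`
    intro hc
    rw [mem_clus] at hc
    rcases (ReflTransGen.cases_tail_iff _ _ _).1 hc with h | ⟨y, _, hyc⟩
    · exact hac h.symm
    · obtain ⟨e, hxe, he⟩ := hyc
      have hey : ends e = s(c, y) := by rw [he, Sym2.eq_swap]
      obtain ⟨-, hopen, -⟩ := key hey
      rw [hflip (by rw [hey]; exact Sym2.mem_mk_left _ _), hopen] at hxe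
      exact absurd hxe (by decide)

open Classical in
/-- **ANTI₁ for nested terminal neighbourhoods** (ungraded, `q = 1`): if `b ≁ c` and `N(c) ⊆ N(b)` then
`#{x : b, c ∈ O_a∖K_a, K_a separates b | c} ≤ #{x : b ∈ O_a∖K_a, c ∈ K_a∖O_a}`, by the injection
`x ↦ x △ star(c)` (an involution of the cube). [this work] -/
theorem card_lSet_le_card_rSet_of_nested (ends : ι → Sym2 V) {a b c : V}
    (hbc : ∀ e, ends e ≠ s(b, c)) (hN : ∀ e y, ends e = s(c, y) → ∃ e', ends e' = s(b, y)) :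
    (lSet ends a b c).card ≤ (rSet ends a b c).card := by
  refine Finset.card_le_card_of_injOn (fun x e => if c ∈ ends e then !x e else x e)
    (fun x hx => flipStar_mem_rSet hbc hN hx (x' := fun e => if c ∈ ends e then !x e else x e)
      fun _ => rfl) ?_
  intro x _ y _ h
  funext e
  have he := congrFun h e
  by_cases hc : c ∈ ends e
  · simp only [hc, if_true] at he
    exact Bool.not_inj he
  · simpa only [hc, if_false] using he

end Nested

end AntipodalR1

end Summit.CriticalPhenomena.PercolationContinuityZ3.Theorems
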